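import Literature.Computability.Complexity.EquivalenceProblems
import Literature.Computability.Complexity.BPExpOperator
import Literature.Computability.Complexity.PromiseBPPAmplificationExp
import Literature.Computability.Complexity.PromiseZPPProofs
import Literature.Computability.Complexity.SipserGacsLautemann
import Literature.Computability.Complexity.EquivalenceProblemsUPSubsetRPProofs
import HarnessLib

/-!
# Complexity classes of equivalence problems: the collapses `CF = Ker ⟹ NP = UP` and
# `CF = PEq ⟹ NP = UP = RP ∧ PH = BPP` (Fortnow–Grochow 2011, Cor. 4.2 and Cor. 4.4)

Sibling proof file of `EquivalenceProblems.lean` (D-0014: the named facts stay `def`s there;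
discharges and proved glue live in the sibling proof files — `EquivalenceProblemsProofs.lean`
(Thm. 4.3, first half), `EquivalenceProblemsUPSubsetRPProofs.lean` (Thm. 4.3, second half), … —
and here: the collapse facts of FG §4.1, Cor. 4.2 and Cor. 4.4).

Fortnow–Grochow 2011 (arXiv:0907.4775), Cor. 4.4: "If `CF = PEq` then `NP = UP = RP` and thus
`PH = BPP`." The printed proof (p. 8 of the arXiv version) is four citations deep and we follow it
literally:

> "If `CF = PEq` then it follows directly from Theorems 4.1 and 4.3 that `NP = UP ⊆ RP`. Thus
> `NP = RP`, since `RP ⊆ NP` without any assumptions. Furthermore, it follows that `PH ⊆ BPP`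
> [Zachos 1988], and since `BPP ⊆ PH` [Lautemann 1983, Sipser 1983], the two are equal."

* `KerFP_subset_PEq` — the "obvious" inclusion `Ker(FP) ⊆ PEq` (FG §1), needed because the fact
  `fortnowGrochow_CF_eq_Ker_NP_eq_UP` (Cor. 4.2) is stated from `Ker(FP) ⊆ CF(FP)` while Cor. 4.4
  assumes `PEq ⊆ CF(FP)`: the recognition problem of `Ker f` is the `P` language
  `{w | ⟨fst w, snd w⟩ = w} ∩ {w | f (fst w) = f (snd w)}` (two equality tests of `FP` maps,
  `setOf_apply_eq_apply_mem_P`).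
* `BPP_subset_bpExp_P` — `BPP = BPₑ·P`: error reduction to `2^{-e(|x|)}` for every polynomial `e`
  (the tree's Chernoff amplifier `PromiseProblem.exists_amplifier_exp_of_mem_PromiseBPP'`, error
  `exp(-(e+1)) ≤ 2^{-e}`), the form in which the `BP·` operator calculus of `BPExpOperator.lean`
  (swap `∃·BPₑ·C ⊆ BPₑ·∃·C`, merge `BPₑ·BPₑ·C ⊆ BPₑ·C`) applies.
* `polyExists_BPP_subset_BPP`, `SigmaP_subset_BPP_of_NP_subset_BPP`,
  **`PH_subset_BPP_of_NP_subset_BPP`** (Zachos 1988: `NP ⊆ BPP ⟹ PH ⊆ BPP`) and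
  `PH_eq_BPP_of_NP_subset_BPP` (with Sipser–Gács–Lautemann `BPP ⊆ Σ₂ᵖ`, proved in the tree):
  `Σₖ₊₁ = ∃·co·Σₖ ⊆ ∃·co·BPP = ∃·BPP ⊆ ∃·BPₑ·P ⊆ BPₑ·∃·P = BPₑ·NP ⊆ BPₑ·BPP ⊆ BPₑ·BPₑ·P ⊆ BPₑ·P ⊆ BPP`.
* `fortnowGrochow_CF_eq_PEq_of` — Cor. 4.4 from its two printed ingredients, the named facts
  `fortnowGrochow_CF_eq_Ker_NP_eq_UP` (Thm. 4.1/Cor. 4.2) and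
  `fortnowGrochow_CF_eq_PEq_UP_subset_RP` (Thm. 4.3), exactly as printed.
* **`fortnowGrochow_CF_eq_Ker_NP_eq_UP_holds`** — the discharge of Cor. 4.2 (`CF = Ker ⟹ NP = UP`,
  the language case of Thm. 4.1 `NPMV_g ⊆_c NPSV_g`), by the printed proof (namespace
  `FortnowGrochowNP`): for `L ∈ NP` with verifier `L' ∈ P` and witness bound `p`, the `FP` map
  `f : ⟨x, y⟩ ↦ 1x` on witness pairs (`|y| ≤ p |x|`, `⟨x, y⟩ ∈ L'`), `w ↦ 0w` elsewhere, has kernel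
  "same input, both witnesses"; a canonical form `c ∈ FP` of `Ker f` (hypothesis `Ker ⊆ CF`)
  selects one witness per `x ∈ L`, and "`y` is a witness of `x` with `c ⟨x, y⟩ = ⟨x, y⟩`" is a `UP`
  verifier for `L` (in `P`: `indicatorFn_mem_FP`, `iteFn`, `LenLe`, equality tests of `FP` maps).
* **`fortnowGrochow_CF_eq_PEq_holds`** — the discharge of Cor. 4.4, feeding `fortnowGrochow_CF_eq_PEq_of`
  with `fortnowGrochow_CF_eq_Ker_NP_eq_UP_holds` (Cor. 4.2, here) and
  `fortnowGrochow_CF_eq_PEq_UP_subset_RP_holds` (`EquivalenceProblemsUPSubsetRPProofs.lean`,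
  Thm. 4.3). (The sibling `EquivalenceProblemsProofs.lean` now holds the discharge of the first
  half of Thm. 4.3, `Ker = PEq ⟹ UP ⊆ BQP`, and is not imported here.)

## References

* L. Fortnow, J. A. Grochow, *Complexity classes of equivalence problems revisited*, Inform.
  Comput. 209 (2011) 748–763 = arXiv:0907.4775 [FortnowGrochow2011], Thm. 4.1, Cor. 4.2, Cor. 4.4
  and their proofs.
* L. Valiant, *Relative complexity of checking and evaluating*, Inform. Process. Lett. 5 (1976)
  (`UP`) [Valiant1976].
* S. Zachos, *Probabilistic quantifiers and games*, JCSS 36 (1988) 433–451 (`NP ⊆ BPP ⟹ PH ⊆ BPP`).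
* C. Lautemann, *BPP and the polynomial hierarchy*, IPL 17 (1983); M. Sipser, *A complexity
  theoretic approach to randomness*, STOC 1983 (`BPP ⊆ Σ₂ᵖ ∩ Π₂ᵖ`).
* S. Arora, B. Barak, *Computational Complexity: A Modern Approach*, CUP 2009, Thm. 7.10 (error
  reduction), Lemma 17.17 (the `BP·` operator calculus).
-/

namespace Literature.Computability.Complexity

open _root_.Computability Brick

namespace FortnowGrochow

/-! ### `Ker(FP) ⊆ PEq` -/

/-- **The range of the pairing is in `P`**: `{w | ⟨fst w, snd w⟩ = w} ∈ P` (an equality test of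
two `FP` maps), and it is exactly the set of well-formed pairs `boolPair x y`. [folklore] -/
theorem setOf_isPair_mem_P : ({w | fanoutFn fstF sndF w = w} : Language Bool) ∈ Classes.P :=
  setOf_apply_eq_apply_mem_P (g := fun w => w) (fanoutFn_mem_FP fstF_mem_FP sndF_mem_FP)
    (PolyTimeComputable.id _)

/-- The recognition problem of a kernel: for any string function `f`,
`relLang (Ker f) = {w | ⟨fst w, snd w⟩ = w} ∩ {w | f (fst w) = f (snd w)}`.
[cite: FortnowGrochow2011, §1 (Ker ⊆ PEq)] -/
theorem relLang_ker_eq {E : List Bool → List Bool → Prop} {f : List Bool → List Bool}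
    (hE : IsCompleteInvariantFor E f) :
    relLang E = ({w | fanoutFn fstF sndF w = w} : Language Bool) ⊓ {w | (f ∘ fstF) w = (f ∘ sndF) w} := by
  ext w
  change (∃ x y, w = boolPair x y ∧ E x y) ↔ fanoutFn fstF sndF w = w ∧ f (fstF w) = f (sndF w)
  constructor
  · rintro ⟨x, y, rfl, hxy⟩
    rw [fanoutFn_apply, fstF_boolPair, sndF_boolPair]
    exact ⟨rfl, (hE x y).1 hxy⟩
  · rintro ⟨hw, hfw⟩
    refine ⟨fstF w, sndF w, ?_, (hE _ _).2 hfw⟩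
    rw [fanoutFn_apply] at hw
    exact hw.symm

end FortnowGrochow

open FortnowGrochow in
/-- **`Ker(FP) ⊆ PEq`** ("It is obvious that `LexEq ⊆ CF ⊆ Ker ⊆ PEq`", Fortnow–Grochow 2011, §1):
the kernel of any function is an equivalence relation, and for `f ∈ FP` its recognition problem
`{⟨x, y⟩ | f x = f y}` is in `P` (decode the pair, run `f` twice, compare).
[cite: FortnowGrochow2011, §1 (Ker ⊆ PEq)] -/
theorem KerFP_subset_PEq : KerFP ⊆ PEq := by
  rintro E ⟨f, hf, hE⟩
  refine ⟨⟨fun x => (hE x x).2 rfl, fun h => (hE _ _).2 ((hE _ _).1 h).symm,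
    fun h₁ h₂ => (hE _ _).2 (((hE _ _).1 h₁).trans ((hE _ _).1 h₂))⟩, ?_⟩
  rw [relLang_ker_eq hE]
  exact inter_mem_P setOf_isPair_mem_P
    (setOf_apply_eq_apply_mem_P (comp_mem_FP hf fstF_mem_FP) (comp_mem_FP hf sndF_mem_FP))

/-- `Ker(FP) ⊆ CF(FP)` under `PEq ⊆ CF(FP)` (the hypothesis "`CF = PEq`" implies "`CF = Ker`").
[cite: FortnowGrochow2011, §1 (CF ⊆ Ker ⊆ PEq)] -/
theorem KerFP_subset_CFFP_of_PEq_subset (h : PEq ⊆ CFFP) : KerFP ⊆ CFFP :=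
  KerFP_subset_PEq.trans h

/-! ### `BPP = BPₑ·P`: error reduction in operator form -/

namespace FortnowGrochow

/-- `exp(-(E+1)) ≤ 2^{-E}` (since `e ≥ 2`). [folklore] -/
theorem exp_neg_succ_le_half_pow (E : ℕ) : Real.exp (-((E : ℝ) + 1)) ≤ (1 / 2 : ℝ) ^ E := by
  have h1 : Real.exp (-1) ≤ 1 / 2 := by
    have h := Real.add_one_le_exp (1 : ℝ)
    rw [Real.exp_neg, inv_le_comm₀ (Real.exp_pos 1) (by norm_num)]
    norm_num at h ⊢
    linarith
  calc Real.exp (-((E : ℝ) + 1)) ≤ Real.exp ((E : ℕ) * (-1 : ℝ)) := Real.exp_le_exp.2 (by linarith)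
    _ = Real.exp (-1) ^ E := Real.exp_nat_mul (-1) E
    _ ≤ (1 / 2) ^ E := pow_le_pow_left₀ (Real.exp_pos _).le h1 E

/-- `P` is closed under polynomial-time preimages (hypothesis shape of `BPExpOperator`). [folklore] -/
theorem P_preimage_closed : ∀ L ∈ Classes.P, ∀ f : List Bool → List Bool, f ∈ FP →
    (f ⁻¹' L : Language Bool) ∈ Classes.P :=
  fun _ hL _ hf => preimage_mem_P hL hf

/-- `P` is closed under intersection with `P` languages (hypothesis shape of `BPExpOperator`). [folklore] -/
theorem P_inf_closed : ∀ L ∈ Classes.P, ∀ A ∈ Classes.P, L ⊓ A ∈ Classes.P :=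
  fun _ hL _ hA => inter_mem_P hL hA

end FortnowGrochow

open FortnowGrochow in
/-- **`BPP ⊆ BPₑ·P`** (error reduction for `BPP`, Arora–Barak 2009, Thm. 7.10, in the operator
form of `bpExp`): for every polynomial `e` a `BPP` language has a witness language in `P` erring on
at most a `2^{-e(|x|)}` fraction of the coin strings — majority vote over `O(e)` runs and the
Chernoff bound, as packaged by the tree's `PromiseProblem.exists_amplifier_exp_of_mem_PromiseBPP'`
(error `≤ exp(-(e+1)) ≤ 2^{-e}`). [cite: AroraBarak2009, Thm. 7.10] -/
theorem BPP_subset_bpExp_P : BPP ⊆ bpExp Classes.P := by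
  intro L hL e
  obtain ⟨L'', hL'', p'', hyes, hno, -⟩ :=
    PromiseProblem.exists_amplifier_exp_of_mem_PromiseBPP' (ofLanguage_mem_PromiseBPP'_iff.2 hL) e
  refine ⟨L'', hL'', p'', fun x => ?_⟩
  have hexp := exp_neg_succ_le_half_pow (e.eval x.length)
  by_cases hx : x ∈ L
  · have hset : {y : List Bool | ¬ (boolPair x y ∈ L'' ↔ x ∈ L)} = {y | boolPair x y ∉ L''} := by
      ext y; simp [hx]
    rw [hset]
    exact (hyes x hx).trans hexp
  · have hset : {y : List Bool | ¬ (boolPair x y ∈ L'' ↔ x ∈ L)} = {y | boolPair x y ∈ L''} := by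
      ext y; simp [hx]
    rw [hset]
    exact (hno x hx).trans hexp

/-- `BPₑ·P = BPP`. [cite: AroraBarak2009, Thm. 7.10] -/
theorem bpExp_P_eq_BPP : bpExp Classes.P = BPP :=
  (bpExp_subset_bp _).antisymm BPP_subset_bpExp_P

/-! ### Zachos: `NP ⊆ BPP ⟹ PH ⊆ BPP` -/

open FortnowGrochow in
/-- **`∃·BPP ⊆ BPP` when `NP ⊆ BPP`** (the inductive step of Zachos 1988; cf. `MA ⊆ AM`):
`∃·BPP ⊆ ∃·BPₑ·P ⊆ BPₑ·∃·P = BPₑ·NP ⊆ BPₑ·BPP ⊆ BPₑ·BPₑ·P ⊆ BPₑ·P ⊆ BPP`, by error reduction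
(`BPP_subset_bpExp_P`), the quantifier swap `BPExp.polyExists_bpExp_subset` (one amplified coin
string serves all witnesses, union bound) and the merge `BPExp.bpExp_bpExp_subset`.
[cite: FortnowGrochow2011, Cor. 4.4 (proof: "PH ⊆ BPP [Zachos]")] -/
theorem polyExists_BPP_subset_BPP (h : Nondeterministic.NP ⊆ BPP) : polyExists BPP ⊆ BPP :=
  calc polyExists BPP ⊆ polyExists (bpExp Classes.P) := polyExists_mono BPP_subset_bpExp_P
    _ ⊆ bpExp (polyExists Classes.P) := BPExp.polyExists_bpExp_subset P_preimage_closed P_inf_closed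
    _ = bpExp Nondeterministic.NP := rfl
    _ ⊆ bpExp BPP := bpExp_mono h
    _ ⊆ bpExp (bpExp Classes.P) := bpExp_mono BPP_subset_bpExp_P
    _ ⊆ bpExp Classes.P := BPExp.bpExp_bpExp_subset P_preimage_closed
    _ ⊆ bp Classes.P := bpExp_subset_bp _
    _ = BPP := rfl

/-- **Every level of `PH` is in `BPP` when `NP ⊆ BPP`** (Zachos 1988), by induction on `k`:
`Σ₀ = P ⊆ BPP`; `Σₖ₊₁ = ∃·co·Σₖ ⊆ ∃·co·BPP = ∃·BPP ⊆ BPP` (`co BPP = BPP`,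
`polyExists_BPP_subset_BPP`). [cite: FortnowGrochow2011, Cor. 4.4 (proof: "PH ⊆ BPP [Zachos]")] -/
theorem SigmaP_subset_BPP_of_NP_subset_BPP (h : Nondeterministic.NP ⊆ BPP) :
    ∀ k : ℕ, SigmaP k ⊆ BPP
  | 0 => by
    rw [SigmaP_zero]
    exact P_subset_BPP_holds
  | k + 1 => by
    have hco : co BPP = BPP := co_BPP_holds
    rw [SigmaP_succ, PiP_eq_co]
    calc polyExists (co (SigmaP k)) ⊆ polyExists (co BPP) :=
        polyExists_mono (co_mono (SigmaP_subset_BPP_of_NP_subset_BPP h k))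
      _ = polyExists BPP := by rw [hco]
      _ ⊆ BPP := polyExists_BPP_subset_BPP h

/-- **Zachos 1988: `NP ⊆ BPP ⟹ PH ⊆ BPP`** (the collapse used in Fortnow–Grochow 2011, Cor. 4.4:
"it follows that `PH ⊆ BPP` [Zachos, *Probabilistic quantifiers and games*, JCSS 36 (1988)]").
[cite: FortnowGrochow2011, Cor. 4.4 (proof: "PH ⊆ BPP [Zachos]")] -/
theorem PH_subset_BPP_of_NP_subset_BPP (h : Nondeterministic.NP ⊆ BPP) : PH ⊆ BPP := by
  intro L hL
  obtain ⟨k, hk⟩ := Set.mem_iUnion.1 hL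
  exact SigmaP_subset_BPP_of_NP_subset_BPP h k hk

/-- **`NP ⊆ BPP ⟹ PH = BPP`**: Zachos' collapse together with Sipser–Gács–Lautemann
`BPP ⊆ Σ₂ᵖ ⊆ PH` (the tree's `BPP_subset_SigmaP_two`), as in the last sentence of the proof of
Fortnow–Grochow 2011, Cor. 4.4. [cite: FortnowGrochow2011, Cor. 4.4 (proof)] -/
theorem PH_eq_BPP_of_NP_subset_BPP (h : Nondeterministic.NP ⊆ BPP) : PH = BPP :=
  (PH_subset_BPP_of_NP_subset_BPP h).antisymm (BPP_subset_SigmaP_two.trans (SigmaP_subset_PH 2))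

/-! ### Cor. 4.4 from Thm. 4.1/Cor. 4.2 and Thm. 4.3 -/

/-- **`NP = RP` from `NP = UP ⊆ RP`** ("Thus `NP = RP`, since `RP ⊆ NP` without any assumptions";
the tree's `RP_subset_NP_holds`). [cite: FortnowGrochow2011, Cor. 4.4 (proof)] -/
theorem NP_eq_RP_of_NP_eq_UP_of_UP_subset_RP (hNPUP : Nondeterministic.NP = UP) (hUPRP : UP ⊆ RP) :
    Nondeterministic.NP = RP :=
  (hNPUP.subset.trans hUPRP).antisymm RP_subset_NP_holds

/-- **Fortnow–Grochow 2011, Cor. 4.4, from its printed ingredients**: given Cor. 4.2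
(`CF = Ker ⟹ NP = UP`, the fact `fortnowGrochow_CF_eq_Ker_NP_eq_UP`) and the second half of Thm. 4.3
(`CF = PEq ⟹ UP ⊆ RP`, the fact `fortnowGrochow_CF_eq_PEq_UP_subset_RP`), "If `CF = PEq` then
`NP = UP = RP` and thus `PH = BPP`": `CF = PEq` gives `CF = Ker` (`KerFP_subset_PEq`), hence
`NP = UP ⊆ RP ⊆ NP`, so `NP = RP ⊆ BPP`, so `PH ⊆ BPP` (Zachos) and `BPP ⊆ PH`
(Sipser–Gács–Lautemann). [cite: FortnowGrochow2011, Cor. 4.4] -/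
theorem fortnowGrochow_CF_eq_PEq_of (h₁ : fortnowGrochow_CF_eq_Ker_NP_eq_UP)
    (h₂ : fortnowGrochow_CF_eq_PEq_UP_subset_RP) : fortnowGrochow_CF_eq_PEq := by
  intro hCF
  have hNPUP : Nondeterministic.NP = UP := h₁ (KerFP_subset_CFFP_of_PEq_subset hCF)
  have hNPRP : Nondeterministic.NP = RP := NP_eq_RP_of_NP_eq_UP_of_UP_subset_RP hNPUP (h₂ hCF)
  have hNPBPP : Nondeterministic.NP ⊆ BPP := hNPRP.subset.trans RP_subset_BPP_holds
  exact ⟨hNPUP, hNPRP, PH_eq_BPP_of_NP_subset_BPP hNPBPP⟩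

/-! ### Cor. 4.2: `CF = Ker ⟹ NP = UP` (Fortnow–Grochow 2011, Thm. 4.1 / Cor. 4.2)

The printed proof of Thm. 4.1 ("`CF = Ker ⟹ NPMV_g ⊆_c NPSV_g`"), specialised to the decision
class as in Cor. 4.2: for an `NP` verifier `(L', p)` let `W = {⟨x, y⟩ : |y| ≤ p(|x|), ⟨x, y⟩ ∈ L'}`
(the graph of the witness multifunction, in `P`) and `f(w) = 1·x` for `w = ⟨x, y⟩ ∈ W`,
`f(w) = 0·w` otherwise; `f ∈ FP` and `Ker f` identifies exactly the witness pairs of a common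
input. A canonical form `c ∈ FP` of `Ker f` maps every witness pair of `x` to one fixed witness
pair `⟨x, y*⟩` of `x`, so `V = {w ∈ W : c(w) = w}` is a `P` verifier accepting the single witness
`y*` of each `x ∈ L`: `L ∈ UP`. The objects `W`, `f`, `V` are passed to the lemmas as variables
with their defining equations (`hW`, `hf`), so that only theorems are declared. -/

namespace FortnowGrochowNP

open FortnowGrochowUP

section Witness

variable {L' : Language Bool} {p : Polynomial ℕ} {W : Language Bool}
  (hW : ∀ w, w ∈ W ↔
    fanoutFn fstF sndF w = w ∧ (sndF w).length ≤ p.eval (fstF w).length ∧ w ∈ L')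

include hW

/-- Pairs in the witness language `W` of an `NP` verifier `(L', p)`: `⟨x, y⟩ ∈ W` iff `y` is a
witness of `x` (`|y| ≤ p(|x|)` and `⟨x, y⟩ ∈ L'`). [cite: FortnowGrochow2011, Thm. 4.1 (proof)] -/
theorem boolPair_mem_witLang {x y : List Bool} :
    boolPair x y ∈ W ↔ y.length ≤ p.eval x.length ∧ boolPair x y ∈ L' := by
  rw [hW, fanoutFn_apply, fstF_boolPair, sndF_boolPair]
  exact ⟨fun h => h.2, fun h => ⟨rfl, h⟩⟩

/-- Members of the witness language are well-formed pairs `⟨fst w, snd w⟩`.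
[cite: FortnowGrochow2011, Thm. 4.1 (proof)] -/
theorem eq_boolPair_of_mem_witLang {w : List Bool} (hw : w ∈ W) :
    w = boolPair (fstF w) (sndF w) := by
  have h := ((hW w).1 hw).1
  rw [fanoutFn_apply] at h
  exact h.symm

/-- **The witness language is in `P`** (`L' ∈ P`): a conjunction of an equality test of `FP`
maps (well-formedness), the preimage of `LenLe p` under `w ↦ ⟨fst w, snd w⟩` (the witness bound)
and `L'` itself. [cite: FortnowGrochow2011, Thm. 4.1 (proof)] -/
theorem witLang_mem_P (hL' : L' ∈ Classes.P) : W ∈ Classes.P := by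
  have hlen : ({w | (sndF w).length ≤ p.eval (fstF w).length} : Language Bool) ∈ Classes.P :=
    mem_P_congr (setOf_apply_mem_mem_P (LenLe_mem_P p) (fanoutFn_mem_FP fstF_mem_FP sndF_mem_FP))
      fun w => by simp
  have hL'' : ({w | w ∈ L'} : Language Bool) ∈ Classes.P := mem_P_congr hL' fun _ => Iff.rfl
  exact mem_P_congr (setOf_and_mem_P FortnowGrochow.setOf_isPair_mem_P (setOf_and_mem_P hlen hL''))
    hW

end Witness

section Fn

variable {W : Language Bool} {f : List Bool → List Bool}
  (hf : ∀ w, f w = bif W.boolIndicator w then true :: fstF w else false :: w)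

include hf

/-- `f(w) = 1·fst w` on `W`. [cite: FortnowGrochow2011, Thm. 4.1 (proof)] -/
theorem fn_apply_of_mem {w : List Bool} (hw : w ∈ W) : f w = true :: fstF w := by
  rw [hf, (Set.mem_iff_boolIndicator _ _).1 hw]
  rfl

/-- `f(w) = 0·w` off `W`. [cite: FortnowGrochow2011, Thm. 4.1 (proof)] -/
theorem fn_apply_of_not_mem {w : List Bool} (hw : w ∉ W) : f w = false :: w := by
  rw [hf, (Set.notMem_iff_boolIndicator _ _).1 hw]
  rfl

/-- **`f ∈ FP`** when `W ∈ P`: branch on the indicator bit of `W` (`indicatorFn_mem_FP`, `iteFn`)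
between `w ↦ 1·fst w` and `w ↦ 0·w` (`cons_mem_FP`, `fstF_mem_FP`).
[cite: FortnowGrochow2011, Thm. 4.1 (proof)] -/
theorem fn_mem_FP (hWP : W ∈ Classes.P) : f ∈ FP := by
  have h : f = iteFn (fun x => encodeBool (W.boolIndicator x)) (List.cons true ∘ fstF)
      (List.cons false) := by
    funext w
    rw [hf, iteFn_apply (c := fun x => encodeBool (W.boolIndicator x)) (b := W.boolIndicator w) rfl]
    cases W.boolIndicator w <;> rfl
  rw [h]
  exact iteFn_mem_FP (indicatorFn_mem_FP hWP) (comp_mem_FP (cons_mem_FP true) fstF_mem_FP)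
    (cons_mem_FP false)

/-- **The kernel of `f`**: two members of `W` are identified iff they have the same first
component (they are witness pairs of the same input); every other string is alone in its class.
[cite: FortnowGrochow2011, Thm. 4.1 (proof)] -/
theorem fn_eq_fn_iff {u v : List Bool} :
    f u = f v ↔ (u ∈ W ∧ v ∈ W ∧ fstF u = fstF v) ∨ (u ∉ W ∧ v ∉ W ∧ u = v) := by
  by_cases hu : u ∈ W <;> by_cases hv : v ∈ W
  · rw [fn_apply_of_mem hf hu, fn_apply_of_mem hf hv]
    simp [hu, hv]
  · rw [fn_apply_of_mem hf hu, fn_apply_of_not_mem hf hv]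
    simp [hu, hv]
  · rw [fn_apply_of_not_mem hf hu, fn_apply_of_mem hf hv]
    simp [hu, hv]
  · rw [fn_apply_of_not_mem hf hu, fn_apply_of_not_mem hf hv]
    simp [hu, hv]

end Fn

end FortnowGrochowNP

open FortnowGrochowUP FortnowGrochowNP in
/-- **Fortnow–Grochow 2011, Cor. 4.2: "If `CF = Ker` then `NP = UP`"** — discharge of the named
fact `fortnowGrochow_CF_eq_Ker_NP_eq_UP` (`Ker(FP) ⊆ CF(FP) → NP = UP`) by the printed proof of
Thm. 4.1: for `L ∈ NP` with verifier `(L', p)`, the kernel of the `FP` map `f` (`⟨x, y⟩ ↦ 1·x` on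
witness pairs, `w ↦ 0·w` elsewhere) is in `Ker(FP)`, hence has a canonical form `c ∈ FP`; the
canonical form of a witness pair of `x` is a `c`-fixed witness pair `⟨x, y*⟩` of `x`, and any two
`c`-fixed witness pairs of `x` coincide, so `{⟨x, y⟩ ∈ W | c ⟨x, y⟩ = ⟨x, y⟩} ∈ P` is a `UP` verifier
for `L` with the same witness bound `p`. (`UP ⊆ NP` unconditionally, `UP_subset_NP`.)
[cite: FortnowGrochow2011, Cor. 4.2] -/
theorem fortnowGrochow_CF_eq_Ker_NP_eq_UP_holds : fortnowGrochow_CF_eq_Ker_NP_eq_UP := by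
  intro hCF
  refine Set.Subset.antisymm ?_ UP_subset_NP
  rintro L ⟨L', hL'P, p, hLiff⟩
  -- the witness language `W = {⟨x, y⟩ : |y| ≤ p(|x|), ⟨x, y⟩ ∈ L'}`
  obtain ⟨W, hW⟩ : ∃ W : Language Bool, ∀ w, w ∈ W ↔
      fanoutFn fstF sndF w = w ∧ (sndF w).length ≤ p.eval (fstF w).length ∧ w ∈ L' :=
    ⟨setOf _, fun _ => Iff.rfl⟩
  have hWP : W ∈ Classes.P := witLang_mem_P hW hL'P
  -- the map `f` of the printed proof; its kernel is in `Ker(FP)`, hence has a canonical form `c`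
  obtain ⟨f, hf⟩ : ∃ f : List Bool → List Bool, ∀ w,
      f w = bif W.boolIndicator w then true :: fstF w else false :: w :=
    ⟨_, fun _ => rfl⟩
  have hKer : (fun u v => f u = f v) ∈ KerFP := ⟨f, fn_mem_FP hf hWP, fun _ _ => Iff.rfl⟩
  obtain ⟨-, c, hcFP, hc⟩ := hCF hKer
  -- the `UP` verifier `V = {w ∈ W : c w = w}`
  obtain ⟨V, hV⟩ : ∃ V : Language Bool, ∀ w, w ∈ V ↔ w ∈ W ∧ c w = w :=
    ⟨setOf _, fun _ => Iff.rfl⟩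
  have hW' : ({w | w ∈ W} : Language Bool) ∈ Classes.P := mem_P_congr hWP fun _ => Iff.rfl
  have hVP : V ∈ Classes.P :=
    mem_P_congr (setOf_and_mem_P hW'
      (setOf_apply_eq_apply_mem_P (g := fun w => w) hcFP (PolyTimeComputable.id _))) hV
  -- the canonical form of a witness pair of `x` is a `c`-fixed witness pair of `x`
  have hcanon : ∀ {w : List Bool}, w ∈ W →
      c w ∈ W ∧ fstF (c w) = fstF w ∧ c (c w) = c w := by
    intro w hw
    have hE : f (c w) = f w := hc.1 w
    rcases (fn_eq_fn_iff hf).1 hE with ⟨hcw, -, hfst⟩ | ⟨-, hw', -⟩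
    · exact ⟨hcw, hfst, hc.2 _ _ hE⟩
    · exact absurd hw hw'
  refine ⟨V, hVP, p, fun x => ⟨fun hx => ?_, ?_⟩, fun x => ?_⟩
  · -- completeness: `x ∈ L` has the witness `snd (c ⟨x, y⟩)` for any witness `y`
    obtain ⟨y, hy, hxy⟩ := (hLiff x).1 hx
    have hw : boolPair x y ∈ W := (boolPair_mem_witLang hW).2 ⟨hy, hxy⟩
    obtain ⟨hcW, hfst, hcc⟩ := hcanon hw
    rw [fstF_boolPair] at hfst
    have hpair : c (boolPair x y) = boolPair x (sndF (c (boolPair x y))) := by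
      have h := eq_boolPair_of_mem_witLang hW hcW
      rwa [hfst] at h
    refine ⟨sndF (c (boolPair x y)), ?_, ?_⟩
    · have h := ((hW _).1 hcW).2.1
      rwa [hfst] at h
    · rw [← hpair]
      exact (hV _).2 ⟨hcW, hcc⟩
  · -- soundness: accepted witnesses are witnesses
    rintro ⟨y, hy, hmem⟩
    exact (hLiff x).2 ⟨y, hy, ((boolPair_mem_witLang hW).1 ((hV _).1 hmem).1).2⟩
  · -- unambiguity: two `c`-fixed witness pairs of `x` are `Ker f`-related, hence equal
    intro y₁ hy₁ y₂ hy₂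
    obtain ⟨hW₁, hc₁⟩ := (hV _).1 hy₁.2
    obtain ⟨hW₂, hc₂⟩ := (hV _).1 hy₂.2
    have hE : f (boolPair x y₁) = f (boolPair x y₂) := by
      rw [fn_apply_of_mem hf hW₁, fn_apply_of_mem hf hW₂, fstF_boolPair, fstF_boolPair]
    have h := hc.2 _ _ hE
    rw [hc₁, hc₂] at h
    simpa using congrArg sndF h

/-! ### Cor. 4.4 (discharge of `fortnowGrochow_CF_eq_PEq`)

Cor. 4.2 (`CF = Ker ⟹ NP = UP`, `fortnowGrochow_CF_eq_Ker_NP_eq_UP_holds`) is discharged above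
and the second half of Thm. 4.3 (`CF = PEq ⟹ UP ⊆ RP`,
`fortnowGrochow_CF_eq_PEq_UP_subset_RP_holds`) in `EquivalenceProblemsUPSubsetRPProofs.lean`; with
the glue above this is Cor. 4.4 as printed. -/

/-- **Fortnow–Grochow 2011, Cor. 4.4: "If `CF = PEq` then `NP = UP = RP` and thus `PH = BPP`"** —
discharge of the named fact `fortnowGrochow_CF_eq_PEq`, literally as printed: from Cor. 4.2
(`fortnowGrochow_CF_eq_Ker_NP_eq_UP_holds`) and Thm. 4.3 (`fortnowGrochow_CF_eq_PEq_UP_subset_RP_holds`)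
`NP = UP ⊆ RP ⊆ NP`, so `NP = RP ⊆ BPP`, hence `PH ⊆ BPP` (Zachos) and `BPP ⊆ PH`
(Sipser–Gács–Lautemann) — assembled in `fortnowGrochow_CF_eq_PEq_of`. [cite: FortnowGrochow2011, Cor. 4.4] -/
theorem fortnowGrochow_CF_eq_PEq_holds : fortnowGrochow_CF_eq_PEq :=
  fortnowGrochow_CF_eq_PEq_of fortnowGrochow_CF_eq_Ker_NP_eq_UP_holds
    fortnowGrochow_CF_eq_PEq_UP_subset_RP_holds

end Literature.Computability.Complexity
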